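import Mathlib
import Summits.Ventures.PercRepro2.Defs
import Summits.Ventures.PercRepro2.Independence
import Summits.Ventures.PercRepro2.Harris
import Summits.Ventures.PercRepro2.Graph
import Summits.Ventures.PercRepro2.Events
import Summits.Ventures.PercRepro2.ZCDismantle
import Summits.Ventures.PercRepro2.ZCDismantle6
import Summits.Ventures.PercRepro2.ZCDismantle6Cor

/-!
# The seven-kind dismantling theorem at work: the mirror insertions I and J on concrete graphs
(blind cell PercRepro2, mine-a g25; MINE-A.md §74.7)

Two instances of `zc_of_dismantling₆_all'` (ZCDismantle6) whose record lists were produced by the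
dismantler `dismantle.py` (data/mine-a/g25/codes) at its level C1 — the placements that need Theorem I
(`o` between `a₃` and `w`, kind `5`) or Theorem J (`a₃` between `o` and `w`, kind `6`).  All side
conditions by `decide`; no definition; one seat.
-/

namespace Summit.Ventures.PercRepro2

/-- **(ZC) on the `2 × 3` grid** `0 — 1 — 2` over `3 — 4 — 5` (rungs `{0,3} {1,4} {2,5}`) with the marks `(0, 2, 5)` — a placement OUTSIDE the five-kind class (`a₃ = 2` has the neighbours `1` and `o = 5`): J at `2` (`w = 1`), F at `0`, then leaves — one of the 24 placements of this grid that the mirror insertions add to the kernel class (84 → 108 of 120). -/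
theorem zc_grid_two_three_J {R : Type*} [CommRing R] [LinearOrder R] [IsStrictOrderedRing R]
    {p : Fin 7 → R} (hp : IsProbVec p) {𝓔 : Set (Set (Fin 6))} (h𝓔 : IsUpperSet 𝓔) :
    let ends : Fin 7 → Sym2 (Fin 6) := ![s(0, 1), s(1, 2), s(3, 4), s(4, 5), s(0, 3), s(1, 4), s(2, 5)]
    let e := connEvent ends 0 2
    let L' := connEvent ends 0 5
    let U := clusterInEvent ends 0 𝓔
    let γ := connEvent ends 2 5
    0 ≤ prob p (eᶜ ∩ L'ᶜ ∩ γᶜ) * (prob p (U ∩ (e ∩ L')) - prob p U * prob p (e ∩ L'))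
      - prob p (eᶜ ∩ L'ᶜ ∩ γ) * (prob p (U ∩ (e ∩ L'ᶜ)) - prob p U * prob p (e ∩ L'ᶜ)) := by
  intro ends e L' U γ
  have h := zc_of_dismantling₆_all' (ends := ends)
    [((6 : Fin 7), (6 : Fin 7), (1 : Fin 7), (2 : Fin 6), (1 : Fin 6), (0 : Fin 6), (2 : Fin 6), (5 : Fin 6)),
     (1, 0, 4, 0, 3, 0, 1, 5),
     (4, 5, 5, 1, 4, 3, 1, 5),
     (4, 2, 2, 3, 4, 3, 4, 5),
     (4, 3, 3, 4, 5, 4, 4, 5)]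
    (by decide) (by decide) (by decide) p hp
    (by intro e _; fin_cases e <;> decide)
    (0, 2, 5) (by intro r hr; simp at hr; rw [← hr]) h𝓔
  simpa using h

/-- **(ZC) on the 7-vertex, 11-edge graph** `c7_00355` with the marks `(3, 0, 2)`: J at `0` (`w = 1`), E at `1`, I at `2` (`w = 6`), H at `3`, F at `4`, leaf `5` at `6` — BOTH mirror insertions in one dismantling, six of the seven record kinds. -/
theorem zc_seven_eleven_IJ {R : Type*} [CommRing R] [LinearOrder R] [IsStrictOrderedRing R]
    {p : Fin 11 → R} (hp : IsProbVec p) {𝓔 : Set (Set (Fin 7))} (h𝓔 : IsUpperSet 𝓔) :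
    let ends : Fin 11 → Sym2 (Fin 7) := ![s(0, 1), s(0, 2), s(1, 3), s(1, 5), s(2, 5), s(2, 6), s(3, 4), s(3, 6), s(4, 5), s(4, 6), s(5, 6)]
    let e := connEvent ends 3 0
    let L' := connEvent ends 3 2
    let U := clusterInEvent ends 3 𝓔
    let γ := connEvent ends 0 2
    0 ≤ prob p (eᶜ ∩ L'ᶜ ∩ γᶜ) * (prob p (U ∩ (e ∩ L')) - prob p U * prob p (e ∩ L'))
      - prob p (eᶜ ∩ L'ᶜ ∩ γ) * (prob p (U ∩ (e ∩ L'ᶜ)) - prob p U * prob p (e ∩ L'ᶜ)) := by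
  intro ends e L' U γ
  have h := zc_of_dismantling₆_all' (ends := ends)
    [((6 : Fin 7), (1 : Fin 11), (0 : Fin 11), (0 : Fin 7), (1 : Fin 7), (3 : Fin 7), (0 : Fin 7), (2 : Fin 7)),
     (0, 2, 3, 1, 5, 3, 1, 2),
     (5, 4, 5, 2, 6, 3, 5, 2),
     (3, 7, 6, 3, 4, 3, 5, 6),
     (1, 8, 9, 4, 6, 4, 5, 6),
     (4, 10, 10, 5, 6, 6, 5, 6)]
    (by decide) (by decide) (by decide) p hp
    (by intro e _; fin_cases e <;> decide)
    (3, 0, 2) (by intro r hr; simp at hr; rw [← hr]) h𝓔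
  simpa using h

end Summit.Ventures.PercRepro2
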